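import Summits.ABC.StewartYu.ArchG3HalfValues
import Summits.ABC.StewartYu.ArchG3KStepDelta
import Literature.NumberTheory.Transcendental.Waldschmidt1980Liouville
import HarnessLib

/-!
# Cell abc-stewartyu, rung A1.L (crux r2 `ArchCoreRat`), WP-L.A parcel P-A6 (Kummer half-step), part 2: SEPARATION at a half point —
# the smallness of `φ_{a,μ}(s/2)` forces every square-class sum to vanish

`Summits/ABC/StewartYu/ArchG3HalfSeparation.lean` — sequel to `ArchG3HalfValues` (cell `abc-stewartyu`, HOME `run/shared/lean/pub/abc-stewartyu/`;
TRANCHE PLAN v1.2 §4′ P-A6; seat lp-1 g8).  Theorems on `ArchG3Setup`; no definition, no named fact.  Archimedean twin of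
`PadicG3HalfSeparation.classSums_eq_zero_of_norm_g3Φ_half_lt` (seat p2-g4) and of the tree's `w80_halfstep` (Waldschmidt 1980 Lemma 3.7 with
the SHARP Liouville inequality `Waldschmidt1980.abs_ev_ge_sharp` in `ℚ(√α₁, …, √αₙ)`):

* `halfClassVec_eq_zero_of_norm_lt` — if the square classes of the positive rationals `αⱼ` are independent (`¬ IsSquare (∏_{j∈T} αⱼ)` for
  non-empty `T` — the frame's 2-Kummer / 2-saturation hypothesis), the class sums `C = halfClassVec R v B pv τ s` have a common denominator
  `D ≥ 1` and total size `Σ_T |C_T| ≤ Mb` (`Mb ≥ 1`), and `‖φ_τ(s/2)‖ < Mb/(4·D·Mb·(∏ H(αⱼ))²)^{2ⁿ}`, then `C = 0`;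
* `norm_archΦ_pvΔ_half_le` — the SMALLNESS of `φ_{a,μ}(s/2)` (`φ_{a,μ} = archΦ R v B (pvΔ pv c e μ) (a, 0)`) for an odd (or any) integer
  `|s| ≤ 6N + 4` from the Δ-invariant of order `T` at the nodes `|x| ≤ N` (`a + |μ| + t ≤ T`): the Hermite–Taylor bound of
  `ArchG3KStepDelta.taylor_jets_archF_pvΔ` / `ArchKStep.norm_le_of_taylor_jets_symm` at the complex point `w = s/2` plus the `f − φ` comparison
  `norm_archF_sub_archΦ_le` there;
* `sum_abs_halfClassVec_le(_of_forall)`, `exists_int_mul_halfClassVec` — class-sum total size and integrality from TERMWISE data (what the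
  record supplies uniformly over the unknown set and the box; consumed by `ArchG3Schedule.halfStep_of_hypU` and seat p5's `ArchG3HalfSupply`);
* `halfClassVec_pvΔ_eq_zero` — both together: under the numerical inequality `hfinal` of the record, every class sum of `φ_{a,μ}` at `s/2`
  vanishes (Nesterenko's (4.36)–(4.45); the input of the descent, part 3).

WHAT THIS IS NOT: no re-indexing / descent to the next level (part 3), no record; no crux moves.

## References
* Yu. V. Nesterenko, LNM 1819 (2003) — §4.3 (4.36)–(4.45), p. 90–92. [Nesterenko2003]
* M. Waldschmidt, Acta Arith. 37 (1980) — Lemma 2.2 (p. 261), Lemma 3.7 and (3.22) (pp. 269–272). [Waldschmidt1980]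
-/

noncomputable section

open Finset Polynomial
open Literature.NumberTheory.Transcendental
open Literature.NumberTheory.Transcendental.CW77 (mono ev heightProd)
open Literature.NumberTheory.Transcendental.CW77.Setup (Tau tauNorm)
open scoped Nat

namespace Summit.ABC.StewartYu

namespace ArchG3Setup

variable (S : ArchG3Setup) {ι : Type*} (R : ι → ℚ[X]) (v : ι → Fin S.n → ℤ)

/-! ### Liouville in `ℚ(√α₁, …, √αₙ)`: small ⇒ all class sums vanish -/

/-- **Separation at a half point**: with independent square classes, a common denominator `D` and total size `Mb` of the class sums,
`‖φ_τ(s/2)‖ < Mb/(4·D·Mb·(∏ H(αⱼ))²)^{2ⁿ}` forces `halfClassVec R v B pv τ s = 0`.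
[cite: Waldschmidt1980, Lemma 2.2 (p. 261) and Lemma 3.7 (p. 272)] [cite: Nesterenko2003, §4.3 (4.42)–(4.45), p. 91–92] -/
theorem halfClassVec_eq_zero_of_norm_lt (hind : ∀ T : Finset (Fin S.n), T.Nonempty → ¬ IsSquare (∏ j ∈ T, S.α j))
    (B : Finset ι) (pv : ι → ℤ) (τ : Tau S.n) (s : ℤ) {D : ℕ} (hD : 1 ≤ D)
    (hden : ∀ T, ∃ z : ℤ, (D : ℚ) * S.halfClassVec R v B pv τ s T = z) {Mb : ℝ} (hMb : 1 ≤ Mb)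
    (hsum : ∑ T, |(S.halfClassVec R v B pv τ s T : ℝ)| ≤ Mb)
    (hsmall : ‖S.archΦ R v B pv τ ((s : ℂ) / 2)‖ < Mb / (4 * D * Mb * heightProd S.α ^ 2) ^ (2 ^ S.n)) :
    S.halfClassVec R v B pv τ s = 0 := by
  by_contra hne
  have h := Waldschmidt1980.abs_ev_ge_sharp S.n S.α S.α_pos hind (S.halfClassVec R v B pv τ s) hne D hD hden Mb hMb hsum
  rw [S.norm_archΦ_half_ev] at hsmall
  linarith

/-! ### The smallness of `φ_{a,μ}(s/2)` from the Δ-invariant -/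

/-- **`φ_{a,μ}` is small at the half points** `s/2`, `|s| ≤ 6N + 4`: under the Δ-invariant of order `T` at the nodes `|x| ≤ N`, for `(a, μ)`
with `a + |μ| + t ≤ T` and the uniform sizes of `kstep_delta_symm` (plus `Wh ≥ ‖(Hasse_a Rᵢ)(s/2)‖`),
`‖archΦ (pvΔ μ) (a,0) (s/2)‖ ≤ e^{|γ|(3N+2)}·(2(2N+1)^{t+1} t (20e)^{(2N+1)t}·((2C)ᵗ e^{|γ|(N+1)}·2ᵃ e^{y/C} ε_N) + B_G E^{−(2N+1)t})`
`+ #B·P·Wh·e^{Lmax(3N+2)}·2V₀|Λ/b_{j₀}|(3N+2)`. [cite: Nesterenko2003, §4.3 (4.36)–(4.41), p. 90–91] -/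
theorem norm_archΦ_pvΔ_half_le (B : Finset ι) (pv : ι → ℤ) {c : ℤ} (hc : c ≠ 0) (e : Fin S.n → ℤ) {T N t : ℕ} (ht : 1 ≤ t)
    (hinv : ∀ x : ℤ, |x| ≤ (N : ℤ) → ∀ (a' : ℕ) (μ' : Fin S.n → ℕ), a' + ∑ k, μ' k < T →
      S.archφ R v B (S.pvΔ v pv c e μ') (a', 0) x = 0)
    {a : ℕ} {μ : Fin S.n → ℕ} (haμ : a + (∑ k, μ k) + t ≤ T) (s : ℤ) (hs : |s| ≤ 6 * (N : ℤ) + 4)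
    {A : Fin S.n → ℝ} (hA : ∀ k, |S.lg k| ≤ A k)
    {Γ : Fin S.n → ℝ} (hΓ0 : ∀ k, 0 ≤ Γ k) (hΓ : ∀ i ∈ B, ∀ k, |(S.zγ (v i) k : ℝ)| ≤ Γ k)
    {P : ℝ} (hP0 : 0 ≤ P) (hP : ∀ i ∈ B, |(S.pvΔ v pv c e μ i : ℝ)| ≤ P)
    {E : ℝ} (hE : 1 ≤ E) (γ : ℝ)
    {Wd : ℝ} (hWd : ∀ i ∈ B, ∀ z : ℂ, ‖z‖ ≤ (3 * E + 1) * (2 * N + 1) + N → ‖(hw R i a).eval z‖ ≤ Wd)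
    {Wn : ℝ} (hWn0 : 0 ≤ Wn)
    (hWn : ∀ i ∈ B, ∀ t₀ < T, ∀ x : ℤ, |x| ≤ (N : ℤ) → |(((hasseDeriv t₀ (R i)).eval (x : ℚ) : ℚ) : ℝ)| ≤ Wn)
    {Wh : ℝ} (hWh : ∀ i ∈ B, ‖(hw R i a).eval ((s : ℂ) / 2)‖ ≤ Wh)
    {Lmax : ℝ} (hL0 : 0 ≤ Lmax) (hL : ∀ i ∈ B, |S.Lsum (v i)| ≤ Lmax)
    {V₀ : ℝ} (hV0 : 0 ≤ V₀) (hV₀ : ∀ i ∈ B, |(v i S.j₀ : ℝ)| ≤ V₀)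
    (hsmall : V₀ * |S.Λ / (S.b S.j₀ : ℝ)| * (3 * N + 2) ≤ 1)
    {Emax : ℝ} (hEm : ∀ i ∈ B, |S.E (v i) - γ| ≤ Emax) {C : ℝ} (hC : 1 ≤ C) :
    ‖S.archΦ R v B (S.pvΔ v pv c e μ) ((a, 0) : Tau S.n) ((s : ℂ) / 2)‖ ≤
      Real.exp (|γ| * (3 * N + 2)) *
          (2 * ((2 * N + 1 : ℕ) : ℝ) ^ (t + 1) * t * (20 * Real.exp 1) ^ ((2 * N + 1) * t) *
              ((2 * C) ^ t * Real.exp (|γ| * (N + 1)) *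
                ((2 : ℝ) ^ a * Real.exp ((∑ k, A k * Γ k) / C) *
                  (B.card * P * Wn * Real.exp (Lmax * N) * (2 * (V₀ * |S.Λ / (S.b S.j₀ : ℝ)| * N))))) +
            B.card * P * Wd * Real.exp (Emax * ((3 * E + 1) * (2 * N + 1) + N)) * (1 / E) ^ ((2 * N + 1) * t)) +
        B.card * P * Wh * Real.exp (Lmax * (3 * N + 2)) * (2 * (V₀ * |S.Λ / (S.b S.j₀ : ℝ)| * (3 * N + 2))) := by
  set pv' := S.pvΔ v pv c e μ with hpv'
  set f : ℂ → ℂ := S.archF R v B pv' ((a, 0) : Tau S.n) with hf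
  set δ : ℝ := |S.Λ / (S.b S.j₀ : ℝ)| with hδ
  have hδ0 : 0 ≤ δ := abs_nonneg _
  have hN0 : (0 : ℝ) ≤ N := Nat.cast_nonneg _
  -- Taylor jets at the old nodes
  have hsmallN : V₀ * |S.Λ / (S.b S.j₀ : ℝ)| * N ≤ 1 :=
    le_trans (mul_le_mul_of_nonneg_left (by linarith) (mul_nonneg hV0 hδ0)) hsmall
  have hjet : ∀ x : ℤ, |x| ≤ (N : ℤ) → ∀ σ, σ < t → ‖iteratedDeriv σ f (x : ℂ)‖ ≤
      σ.factorial * ((2 * C) ^ σ * ((2 : ℝ) ^ a * Real.exp ((∑ k, A k * Γ k) / C) *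
        (B.card * P * Wn * Real.exp (Lmax * N) * (2 * (V₀ * |S.Λ / (S.b S.j₀ : ℝ)| * N))))) := by
    intro x hx
    exact S.taylor_jets_archF_pvΔ R v B pv hc e ht haμ x hx (hinv x hx) hA hΓ0 hΓ hP0 hP hWn0
      (fun i hi t₀ ht₀ => hWn i hi t₀ ht₀ x hx) hL0 hL hV0 hV₀ hsmallN hC
  -- growth on the big disc
  have hBG : ∀ z : ℂ, ‖z‖ ≤ (3 * E + 1) * (2 * N + 1) + N →
      ‖Complex.exp (-(γ : ℂ) * z) * f z‖ ≤ B.card * P * Wd * Real.exp (Emax * ((3 * E + 1) * (2 * N + 1) + N)) := by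
    intro z hz
    have h := S.norm_exp_mul_archF_le_of_disc R v γ B pv' ((a, 0) : Tau S.n) hz hP (fun i hi => hWd i hi z hz) hΓ hEm
    simpa using h
  -- Hermite at `w = s/2`
  have hw : ‖(s : ℂ) / 2‖ ≤ 3 * N + 2 := by
    rw [norm_div, Complex.norm_intCast, Complex.norm_ofNat, div_le_iff₀ (by norm_num : (0 : ℝ) < 2)]
    have : (|s| : ℝ) ≤ 6 * N + 4 := by exact_mod_cast hs
    linarith
  have h2C : 1 ≤ 2 * C := by linarith
  have hε0 : 0 ≤ (2 : ℝ) ^ a * Real.exp ((∑ k, A k * Γ k) / C) *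
      (B.card * P * Wn * Real.exp (Lmax * N) * (2 * (V₀ * |S.Λ / (S.b S.j₀ : ℝ)| * N))) := by positivity
  have hF := ArchKStep.norm_le_of_taylor_jets_symm (S.differentiable_archF R v B pv' (a, 0)) (-(γ : ℂ)) N ht h2C hε0 hE
    hjet hBG hw
  have hγ : ‖-(γ : ℂ)‖ = |γ| := by rw [norm_neg, Complex.norm_real, Real.norm_eq_abs]
  rw [hγ] at hF
  set Aval : ℝ := 2 * ((2 * N + 1 : ℕ) : ℝ) ^ (t + 1) * t * (20 * Real.exp 1) ^ ((2 * N + 1) * t) *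
      ((2 * C) ^ t * Real.exp (|γ| * (N + 1)) *
        ((2 : ℝ) ^ a * Real.exp ((∑ k, A k * Γ k) / C) *
          (B.card * P * Wn * Real.exp (Lmax * N) * (2 * (V₀ * |S.Λ / (S.b S.j₀ : ℝ)| * N))))) +
    B.card * P * Wd * Real.exp (Emax * ((3 * E + 1) * (2 * N + 1) + N)) * (1 / E) ^ ((2 * N + 1) * t) with hAval
  have hWd0 : 0 ≤ B.card * P * Wd * Real.exp (Emax * ((3 * E + 1) * (2 * N + 1) + N)) :=
    le_trans (norm_nonneg _) (hBG 0 (by simp; positivity))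
  have hAval0 : 0 ≤ Aval := by rw [hAval]; positivity
  have hexp : Real.exp (|γ| * ‖(s : ℂ) / 2‖) ≤ Real.exp (|γ| * (3 * N + 2)) :=
    Real.exp_le_exp.mpr (mul_le_mul_of_nonneg_left hw (abs_nonneg _))
  have hF' : ‖f ((s : ℂ) / 2)‖ ≤ Real.exp (|γ| * (3 * N + 2)) * Aval := hF.trans (mul_le_mul_of_nonneg_right hexp hAval0)
  -- the comparison at `s/2`
  have hcmp0 := S.norm_archF_sub_archΦ_le R v B pv' ((a, 0) : Tau S.n) hw hP hWh hΓ hL hV₀ hsmall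
  have hcmp : ‖f ((s : ℂ) / 2) - S.archΦ R v B pv' ((a, 0) : Tau S.n) ((s : ℂ) / 2)‖ ≤
      B.card * P * Wh * Real.exp (Lmax * (3 * N + 2)) * (2 * (V₀ * |S.Λ / (S.b S.j₀ : ℝ)| * (3 * N + 2))) := by
    refine hcmp0.trans (le_of_eq ?_)
    simp only [Finset.prod_const_one, Pi.zero_apply, pow_zero, mul_one]
  have htri : ‖S.archΦ R v B pv' ((a, 0) : Tau S.n) ((s : ℂ) / 2)‖ ≤
      ‖f ((s : ℂ) / 2)‖ + ‖f ((s : ℂ) / 2) - S.archΦ R v B pv' ((a, 0) : Tau S.n) ((s : ℂ) / 2)‖ := by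
    have := norm_sub_le (f ((s : ℂ) / 2)) (f ((s : ℂ) / 2) - S.archΦ R v B pv' ((a, 0) : Tau S.n) ((s : ℂ) / 2))
    rwa [sub_sub_cancel] at this
  rw [hAval] at hF'
  linarith

/-- **THE SEPARATION STEP** (print (4.36)–(4.45)): under the hypotheses of `norm_archΦ_pvΔ_half_le`, independent square classes, a common
denominator `D ≥ 1` and total size `Mb ≥ 1` of the class sums of `φ_{a,μ}` at `s/2`, and the record's inequality
`(smallness bound of norm_archΦ_pvΔ_half_le) < Mb/(4·D·Mb·(∏H(αⱼ))²)^{2ⁿ}`, every class sum vanishes: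
`halfClassVec R v B (pvΔ pv c e μ) (a,0) s = 0`. [cite: Nesterenko2003, §4.3 (4.36)–(4.45), p. 90–92] [cite: Waldschmidt1980, Lemma 3.7 (p. 272)] -/
theorem halfClassVec_pvΔ_eq_zero (hind : ∀ T : Finset (Fin S.n), T.Nonempty → ¬ IsSquare (∏ j ∈ T, S.α j))
    (B : Finset ι) (pv : ι → ℤ) {c : ℤ} (hc : c ≠ 0) (e : Fin S.n → ℤ) {T N t : ℕ} (ht : 1 ≤ t)
    (hinv : ∀ x : ℤ, |x| ≤ (N : ℤ) → ∀ (a' : ℕ) (μ' : Fin S.n → ℕ), a' + ∑ k, μ' k < T →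
      S.archφ R v B (S.pvΔ v pv c e μ') (a', 0) x = 0)
    {a : ℕ} {μ : Fin S.n → ℕ} (haμ : a + (∑ k, μ k) + t ≤ T) (s : ℤ) (hs : |s| ≤ 6 * (N : ℤ) + 4)
    {A : Fin S.n → ℝ} (hA : ∀ k, |S.lg k| ≤ A k)
    {Γ : Fin S.n → ℝ} (hΓ0 : ∀ k, 0 ≤ Γ k) (hΓ : ∀ i ∈ B, ∀ k, |(S.zγ (v i) k : ℝ)| ≤ Γ k)
    {P : ℝ} (hP0 : 0 ≤ P) (hP : ∀ i ∈ B, |(S.pvΔ v pv c e μ i : ℝ)| ≤ P)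
    {E : ℝ} (hE : 1 ≤ E) (γ : ℝ)
    {Wd : ℝ} (hWd : ∀ i ∈ B, ∀ z : ℂ, ‖z‖ ≤ (3 * E + 1) * (2 * N + 1) + N → ‖(hw R i a).eval z‖ ≤ Wd)
    {Wn : ℝ} (hWn0 : 0 ≤ Wn)
    (hWn : ∀ i ∈ B, ∀ t₀ < T, ∀ x : ℤ, |x| ≤ (N : ℤ) → |(((hasseDeriv t₀ (R i)).eval (x : ℚ) : ℚ) : ℝ)| ≤ Wn)
    {Wh : ℝ} (hWh : ∀ i ∈ B, ‖(hw R i a).eval ((s : ℂ) / 2)‖ ≤ Wh)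
    {Lmax : ℝ} (hL0 : 0 ≤ Lmax) (hL : ∀ i ∈ B, |S.Lsum (v i)| ≤ Lmax)
    {V₀ : ℝ} (hV0 : 0 ≤ V₀) (hV₀ : ∀ i ∈ B, |(v i S.j₀ : ℝ)| ≤ V₀)
    (hsmall : V₀ * |S.Λ / (S.b S.j₀ : ℝ)| * (3 * N + 2) ≤ 1)
    {Emax : ℝ} (hEm : ∀ i ∈ B, |S.E (v i) - γ| ≤ Emax) {C : ℝ} (hC : 1 ≤ C)
    {D : ℕ} (hD : 1 ≤ D) (hden : ∀ T', ∃ z : ℤ, (D : ℚ) * S.halfClassVec R v B (S.pvΔ v pv c e μ) ((a, 0) : Tau S.n) s T' = z)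
    {Mb : ℝ} (hMb : 1 ≤ Mb) (hsum : ∑ T', |(S.halfClassVec R v B (S.pvΔ v pv c e μ) ((a, 0) : Tau S.n) s T' : ℝ)| ≤ Mb)
    (hfinal : Real.exp (|γ| * (3 * N + 2)) *
          (2 * ((2 * N + 1 : ℕ) : ℝ) ^ (t + 1) * t * (20 * Real.exp 1) ^ ((2 * N + 1) * t) *
              ((2 * C) ^ t * Real.exp (|γ| * (N + 1)) *
                ((2 : ℝ) ^ a * Real.exp ((∑ k, A k * Γ k) / C) *
                  (B.card * P * Wn * Real.exp (Lmax * N) * (2 * (V₀ * |S.Λ / (S.b S.j₀ : ℝ)| * N))))) +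
            B.card * P * Wd * Real.exp (Emax * ((3 * E + 1) * (2 * N + 1) + N)) * (1 / E) ^ ((2 * N + 1) * t)) +
        B.card * P * Wh * Real.exp (Lmax * (3 * N + 2)) * (2 * (V₀ * |S.Λ / (S.b S.j₀ : ℝ)| * (3 * N + 2))) <
      Mb / (4 * D * Mb * heightProd S.α ^ 2) ^ (2 ^ S.n)) :
    S.halfClassVec R v B (S.pvΔ v pv c e μ) ((a, 0) : Tau S.n) s = 0 :=
  S.halfClassVec_eq_zero_of_norm_lt R v hind B _ _ s hD hden hMb hsum
    (lt_of_le_of_lt (S.norm_archΦ_pvΔ_half_le R v B pv hc e ht hinv haμ s hs hA hΓ0 hΓ hP0 hP hE γ hWd hWn0 hWn hWh hL0 hL hV0 hV₀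
      hsmall hEm hC) hfinal)

/-! ### From termwise data to the class sums (the record knows the terms, not the fibres) -/

/-- **Total size of the class sums** is at most the total size of the terms: `Σ_T |C_T| ≤ Σ_{i∈B} |pv′ᵢ|·|rHalf i|`. [folklore] -/
theorem sum_abs_halfClassVec_le (B : Finset ι) (pv' : ι → ℤ)
    (τ : Tau S.n) (s : ℤ) :
    ∑ T₁, |(S.halfClassVec R v B pv' τ s T₁ : ℝ)| ≤ ∑ i ∈ B, |(pv' i : ℝ)| * |(S.rHalf R v i τ s : ℝ)| := by
  classical
  calc ∑ T₁, |(S.halfClassVec R v B pv' τ s T₁ : ℝ)|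
      ≤ ∑ T₁, ∑ i ∈ B with S.oddSet (v i) s = T₁, |(pv' i : ℝ)| * |(S.rHalf R v i τ s : ℝ)| := by
        refine sum_le_sum fun T₁ _ => ?_
        unfold halfClassVec
        push_cast
        refine (abs_sum_le_sum_abs _ _).trans (le_of_eq (sum_congr rfl fun i _ => abs_mul _ _))
    _ = ∑ i ∈ B, |(pv' i : ℝ)| * |(S.rHalf R v i τ s : ℝ)| :=
        Finset.sum_fiberwise B (fun i => S.oddSet (v i) s) (fun i => |(pv' i : ℝ)| * |(S.rHalf R v i τ s : ℝ)|)

/-- **Total size of the class sums from a termwise bound**: `|pv′ᵢ| ≤ P′`, `|rHalf i| ≤ Mt` on `B` ⇒ `Σ_T |C_T| ≤ #B·P′·Mt`. [folklore] -/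
theorem sum_abs_halfClassVec_le_of_forall (B : Finset ι) (pv' : ι → ℤ)
    (τ : Tau S.n) (s : ℤ) {P' Mt : ℝ} (hP : ∀ i ∈ B, |(pv' i : ℝ)| ≤ P') (hMt : ∀ i ∈ B, |(S.rHalf R v i τ s : ℝ)| ≤ Mt) :
    ∑ T₁, |(S.halfClassVec R v B pv' τ s T₁ : ℝ)| ≤ B.card * P' * Mt := by
  refine (S.sum_abs_halfClassVec_le R v B pv' τ s).trans ?_
  calc ∑ i ∈ B, |(pv' i : ℝ)| * |(S.rHalf R v i τ s : ℝ)| ≤ ∑ i ∈ B, P' * Mt :=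
        sum_le_sum fun i hi => mul_le_mul (hP i hi) (hMt i hi) (abs_nonneg _) ((abs_nonneg _).trans (hP i hi))
    _ = B.card * P' * Mt := by rw [sum_const, nsmul_eq_mul]; ring

/-- **Integrality of the class sums from the terms**: `D·rHalf i ∈ ℤ` on `B` and integer coefficients ⇒ `D·C_T ∈ ℤ`. [folklore] -/
theorem exists_int_mul_halfClassVec (B : Finset ι) (pv' : ι → ℤ)
    (τ : Tau S.n) (s : ℤ) {D : ℕ} (hint : ∀ i ∈ B, ∃ z : ℤ, (D : ℚ) * S.rHalf R v i τ s = z) (T₁ : Finset (Fin S.n)) :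
    ∃ z : ℤ, (D : ℚ) * S.halfClassVec R v B pv' τ s T₁ = z := by
  classical
  unfold halfClassVec
  rw [mul_sum]
  have hterm : ∀ i ∈ B.filter (fun i => S.oddSet (v i) s = T₁), ∃ z : ℤ, (D : ℚ) * ((pv' i : ℚ) * S.rHalf R v i τ s) = z := by
    intro i hi
    obtain ⟨z, hz⟩ := hint i (mem_filter.mp hi).1
    exact ⟨pv' i * z, by push_cast; rw [← hz]; ring⟩
  choose z hz using hterm
  refine ⟨∑ i ∈ (B.filter (fun i => S.oddSet (v i) s = T₁)).attach, z i.1 i.2, ?_⟩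
  push_cast
  rw [← sum_attach]
  exact sum_congr rfl fun i _ => hz i.1 i.2

end ArchG3Setup

end Summit.ABC.StewartYu

end
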